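import Mathlib.Topology.Algebra.OpenSubgroup
import Literature.AnabelianGeometry.SemiGraphs.UniversalCoveringOverLevels
import Literature.AnabelianGeometry.SemiGraphs.UniversalCoveringOverDescent
import Literature.AnabelianGeometry.SemiGraphs.TemperedPiSystem
import Literature.AnabelianGeometry.SemiGraphs.OrbitGraphFinite
import HarnessLib

/-!
# The trees `𝔾̃_n` and finite levels `𝔾_n` of a Galois tower, with the action of `π₁^temp` ([SemiAnbd] §3 pp. 38, 41)

Mochizuki, *Semi-graphs of anabelioids*, Publ. RIMS **42** (2006), §3: proof of Prop. 3.6, p. 38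
[cite: MochizukiSemiAnbd2006, Prop 3.6 p.38] (`π₁^temp(𝒢) := lim Gal(𝒢_{∞,i}/𝒢)`, "compatible maps
`𝒢_{∞,j} → 𝒢_{∞,i}`") and proof of Thm. 3.7 (iii), p. 41 [cite: MochizukiSemiAnbd2006, Thm 3.7(iii) p.41]
("`H ⊆ π₁^temp(𝒢)` … acts continuously on the semi-graph `𝒢_{∞,i}` … this action factors through a
finite quotient … the action of `H` is over `𝒢`"; "natural maps `V_i → V_j`"; the finite semi-graphs `𝔾_j`).

For GALOIS LEVEL DATA `D : GaloisLevelData 𝒢` (abc-iut-L3-t9's `TemperedPiSystem.lean`: a tower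
`S 0 ⟵ S 1 ⟵ ⋯` of coverings with point-transitive endomorphisms, base points `x n` over `v₀`, the
groups `D.Gal n = Aut(𝒢_{∞,S n})` with `step`, and `D.temperedPi = lim_n D.Gal n` with the projections
`D.proj n`) this file instantiates the TREE / LEVEL half of the level data consumed by Thm. 3.7 (iii)
(interface `TemperedLevelData.lean` / `TemperedLevelDictionary`), from the bricks of
`UniversalCoveringOverOrbitGraph/Galois/Levels.lean`:

* `D.tree n = 𝔾̃_{S n}` (the universal graph-covering of `𝔾_{S n}` at the base orbit `W n`), a tree
  (`isTree_tree`), with a vertex (`treeVertex`), over `𝔾` (`treeProj`), identified with the underlying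
  semi-graph of `D.cover n = 𝒢_{∞,S n}` (`treeIso`);
* the actions `D.galTreeAct n : D.Gal n →* Aut (D.tree n)` and
  `D.treeAct n : D.temperedPi →* Aut (D.tree n)` (OPEN kernel `isOpen_ker_treeAct`, over `𝔾`:
  `treeAct_over`);
* the transition `D.treeStep n : D.tree (n+1) ⟶ D.tree n`, over `𝔾` (`treeStep_over`), EQUIVARIANT
  (`treeStep_galAct` for `step`, `treeStep_act` for `π₁^temp`);
* the finite levels `𝔾_{S n} = (D.S n).orbitGraph` (finite when `S n` and `𝔾` are:
  `finite_levelVertex/Branch`), the graph-coverings `D.treeQuot n : D.tree n ⟶ 𝔾_{S n}` (immersions,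
  `treeQuot_isImmersion`), the level actions `D.galLevelAct`/`D.levelAct` (for connected levels) with
  the squares `treeQuot_galAct`/`treeQuot_act` (`act_quot`), `levelStep_galAct`/`levelStep_act`
  (`levelTrans_act`) and `treeStep_quot` (`trans_quot`).

The identifications (I1)–(I3) and the branch dictionary (DV)–(DN) are NOT here (they need the chart of
Prop. 3.6 (ii)).  Seat abc-iut-L3-t6 (row «P-TREE»). Nothing here bears on [IUTchIII] Cor. 3.12.
-/

namespace Literature.AnabelianGeometry.SemiGraphs

namespace ProfiniteSemiGraph

open CategoryTheory Topology

universe u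

variable {𝒢 : ProfiniteSemiGraph.{u}}

/-- Descent across the `eqToIso` of a base-point equality does not change the descended
endomorphism. [cite: MochizukiSemiAnbd2006, Prop 3.6 p.38] -/
theorem CovObj.descendBase_conjAut_eqToIso (S : CovObj 𝒢) (h𝒢 : 𝒢.IsCountable) {V V' : S.OVertex}
    (h : V = V')
    (htrans : ∀ (v : 𝒢.graph.Vertex) (x x' : (S.SV v).obj.V), ∃ σ : S ⟶ S, (σ.fV v).hom.hom x = x')
    (σ : Aut (S.univCoverOver (Sum.inl V) h𝒢)) :
    S.descendBase h𝒢 V' htrans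
        ((eqToIso (congrArg (fun V => S.univCoverOver (Sum.inl V) h𝒢) h)).conjAut σ).hom =
      S.descendBase h𝒢 V htrans σ.hom := by
  subst h
  simp [Iso.conjAut_apply]

section TreeMapV

variable {T S : CovObj 𝒢} (f : T ⟶ S) (W : T.OVertex) (h𝒢 : 𝒢.IsCountable)

/-- `treeMap` at a VERTEX base point, with codomain spelled `𝔾̃_S` based at `Sum.inl (f̄ W)` (the
spelling used by `CovObj.projOver`/`CovObj.descend`; definitionally `CovObj.treeMap f (Sum.inl W)`).
[cite: MochizukiSemiAnbd2006, Thm 3.7(iii) p.41] -/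
noncomputable def CovObj.treeMapV :
    T.orbitGraph.univCover (Sum.inl W) ⟶ S.orbitGraph.univCover (Sum.inl (CovObj.OVertex.map f W)) :=
  CovObj.treeMap f (Sum.inl W)

/-- `treeMapV` is `treeMap`. [cite: MochizukiSemiAnbd2006, Thm 3.7(iii) p.41] -/
theorem CovObj.treeMapV_eq : CovObj.treeMapV f W = CovObj.treeMap f (Sum.inl W) := rfl

/-- `treeMapV f W` lies over `f̄` (the `trans_quot` shape). [cite: MochizukiSemiAnbd2006, Thm 3.7(iii) p.41] -/
theorem CovObj.treeMapV_comp_univCoverProj :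
    CovObj.treeMapV f W ≫ S.orbitGraph.univCoverProj (Sum.inl (CovObj.OVertex.map f W)) =
      T.orbitGraph.univCoverProj (Sum.inl W) ≫ CovObj.orbitGraphMap f :=
  CovObj.treeMap_comp_univCoverProj f (Sum.inl W)

/-- Equivariance of `treeMapV` for a pair of automorphisms intertwined by `projOver` (the `trans_act`
shape). [cite: MochizukiSemiAnbd2006, Thm 3.7(iii) p.41] -/
theorem CovObj.autUnivCover_hom_comp_treeMapV (σ : Aut (T.univCoverOver (Sum.inl W) h𝒢))
    (σ' : Aut (S.univCoverOver (Sum.inl (CovObj.OVertex.map f W)) h𝒢))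
    (hσ : σ.hom ≫ CovObj.projOver f W h𝒢 = CovObj.projOver f W h𝒢 ≫ σ'.hom) :
    (T.autUnivCover (Sum.inl W) h𝒢 σ).hom ≫ CovObj.treeMapV f W =
      CovObj.treeMapV f W ≫ (S.autUnivCover (Sum.inl (CovObj.OVertex.map f W)) h𝒢 σ').hom :=
  CovObj.autUnivCover_hom_comp_treeMap f (Sum.inl W) h𝒢 σ σ' hσ

end TreeMapV

namespace GaloisLevelData

variable (D : GaloisLevelData 𝒢) (h𝒢 : 𝒢.IsCountable)

/-! ### The trees `𝔾̃_n` -/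

/-- **The tree `𝔾̃_n`**: the universal graph-covering of the underlying semi-graph `𝔾_{S n}` of the
`n`-th level, based at the base vertex-orbit `W n` ("`𝒢_{∞,i}` … the universal graph-covering of the
underlying semi-graph `𝔾_i`", p. 38). [cite: MochizukiSemiAnbd2006, Prop 3.6 p.38] -/
noncomputable def tree (n : ℕ) : SemiGraph.{u} := (D.S n).orbitGraph.univCover (Sum.inl (D.W n))

/-- `𝔾̃_n` is a tree. [cite: MochizukiSemiAnbd2006, Thm 3.7(iii) p.41] -/
theorem isTree_tree (n : ℕ) : (D.tree n).IsTree := SemiGraph.univCover_isTree _ _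

/-- The base vertex `(W n, 𝟙)` of `𝔾̃_n`. [cite: MochizukiSemiAnbd2006, Prop 3.6 p.38] -/
noncomputable def treeVertex (n : ℕ) : (D.tree n).Vertex := ⟨D.W n, 𝟙 _⟩

/-- The graph-covering `𝔾̃_n → 𝔾_{S n}`. [cite: MochizukiSemiAnbd2006, Prop 3.6 p.38] -/
noncomputable def treeQuot (n : ℕ) : D.tree n ⟶ (D.S n).orbitGraph :=
  (D.S n).orbitGraph.univCoverProj (Sum.inl (D.W n))

/-- `𝔾̃_n → 𝔾_{S n}` is an immersion (indeed a graph-covering). [cite: MochizukiSemiAnbd2006, §1 p.15] -/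
theorem treeQuot_isImmersion (n : ℕ) : SemiGraph.IsImmersion (D.treeQuot n) :=
  (SemiGraph.isGraphCovering_univCoverProj _ _).2.isImmersion

/-- The structure morphism `𝔾̃_n → 𝔾`. [cite: MochizukiSemiAnbd2006, Thm 3.7(iii) p.41] -/
noncomputable def treeProj (n : ℕ) : D.tree n ⟶ 𝒢.graph := D.treeQuot n ≫ (D.S n).orbitGraphProj

/-- **`𝔾̃_n` is the underlying semi-graph of `𝒢_{∞,n} = D.cover n`** (the identification (B5)).
[cite: MochizukiSemiAnbd2006, Prop 3.6 p.38] -/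
noncomputable def treeIso (n : ℕ) : (D.cover h𝒢 n).orbitGraph ≅ D.tree n :=
  (D.S n).univCoverOverOrbitGraphIso (Sum.inl (D.W n)) h𝒢

/-! ### The actions of `Gal(𝒢_{∞,n}/𝒢)` and of `π₁^temp` on `𝔾̃_n` -/

/-- The action of `G_n = Aut(𝒢_{∞,n})` on the tree `𝔾̃_n`. [cite: MochizukiSemiAnbd2006, Thm 3.7(iii) p.41] -/
noncomputable def galTreeAct (n : ℕ) : D.Gal h𝒢 n →* Aut (D.tree n) :=
  (D.S n).autUnivCover (Sum.inl (D.W n)) h𝒢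

/-- The action of `G_n` on `𝔾̃_n` is over `𝔾`. [cite: MochizukiSemiAnbd2006, Thm 3.7(iii) p.41] -/
theorem galTreeAct_over (n : ℕ) (σ : D.Gal h𝒢 n) :
    (D.galTreeAct h𝒢 n σ).hom ≫ D.treeProj n = D.treeProj n :=
  (D.S n).autUnivCover_hom_comp_proj (Sum.inl (D.W n)) h𝒢 σ

/-- **The action of `π₁^temp(𝒢) = lim_n G_n` on the tree `𝔾̃_n`** (through the projection `ρ_n`).
[cite: MochizukiSemiAnbd2006, Thm 3.7(iii) p.41] -/
noncomputable def treeAct (n : ℕ) : D.temperedPi h𝒢 →* Aut (D.tree n) :=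
  (D.galTreeAct h𝒢 n).comp (D.proj h𝒢 n)

/-- `treeAct` unfolded. [cite: MochizukiSemiAnbd2006, Thm 3.7(iii) p.41] -/
theorem treeAct_apply (n : ℕ) (g : D.temperedPi h𝒢) :
    D.treeAct h𝒢 n g = D.galTreeAct h𝒢 n (D.proj h𝒢 n g) := rfl

/-- The action of `π₁^temp` on `𝔾̃_n` is over `𝔾` ("the action of `H` is over `𝒢`", p. 41).
[cite: MochizukiSemiAnbd2006, Thm 3.7(iii) p.41] -/
theorem treeAct_over (n : ℕ) (g : D.temperedPi h𝒢) :
    (D.treeAct h𝒢 n g).hom ≫ D.treeProj n = D.treeProj n :=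
  D.galTreeAct_over h𝒢 n _

/-- The kernel of `ρ_n : π₁^temp → G_n` is open. [cite: MochizukiSemiAnbd2006, Prop 3.6 p.38] -/
theorem isOpen_ker_proj (n : ℕ) : IsOpen ((D.proj h𝒢 n).ker : Set (D.temperedPi h𝒢)) := by
  rw [MonoidHom.coe_ker]
  exact (isOpen_discrete _).preimage (D.continuous_proj h𝒢 n)

/-- **"This action factors through a finite quotient"** (p. 41): the kernel of the action of `π₁^temp`
on `𝔾̃_n` is open (it contains the open kernel of `ρ_n`). [cite: MochizukiSemiAnbd2006, Thm 3.7(iii) p.41] -/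
theorem isOpen_ker_treeAct (n : ℕ) : IsOpen ((D.treeAct h𝒢 n).ker : Set (D.temperedPi h𝒢)) := by
  refine Subgroup.isOpen_mono (fun g hg => ?_) (D.isOpen_ker_proj h𝒢 n)
  rw [MonoidHom.mem_ker] at hg ⊢
  rw [treeAct_apply, hg, map_one]

/-! ### The transition `𝔾̃_{n+1} → 𝔾̃_n` -/

/-- **The transition morphism of trees `𝔾̃_{n+1} → 𝔾̃_n`** ("compatible maps `𝒢_{∞,j} → 𝒢_{∞,i}`",
p. 38; "natural maps `V_i → V_j`", p. 41): the morphism of universal graph-coverings induced by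
`𝔾_{S (n+1)} → 𝔾_{S n}`, followed by the change of base point along `ḡ_n W_{n+1} = W_n`.
[cite: MochizukiSemiAnbd2006, Thm 3.7(iii) p.41] -/
noncomputable def treeStep (n : ℕ) : D.tree (n + 1) ⟶ D.tree n :=
  CovObj.treeMapV (D.g n) (D.W (n + 1)) ≫
    eqToHom (congrArg (fun V => (D.S n).orbitGraph.univCover (Sum.inl V)) (D.hW n))

/-- The transition of trees covers the transition `𝔾_{S (n+1)} → 𝔾_{S n}` of the finite levels (the
`trans_quot` square). [cite: MochizukiSemiAnbd2006, Thm 3.7(iii) p.41] -/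
theorem treeStep_quot (n : ℕ) :
    D.treeStep n ≫ D.treeQuot n = D.treeQuot (n + 1) ≫ CovObj.orbitGraphMap (D.g n) := by
  change (CovObj.treeMapV (D.g n) (D.W (n + 1)) ≫ eqToHom _) ≫ _ = _
  rw [Category.assoc]
  exact (congrArg (CovObj.treeMapV (D.g n) (D.W (n + 1)) ≫ ·)
    ((D.S n).orbitGraph.eqToHom_comp_univCoverProj (congrArg Sum.inl (D.hW n)))).trans
    (CovObj.treeMapV_comp_univCoverProj (D.g n) (D.W (n + 1)))

/-- The transition of trees lies over `𝔾` (the `trans_over` shape). [cite: MochizukiSemiAnbd2006, Thm 3.7(iii) p.41] -/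
theorem treeStep_over (n : ℕ) : D.treeStep n ≫ D.treeProj n = D.treeProj (n + 1) := by
  change D.treeStep n ≫ D.treeQuot n ≫ (D.S n).orbitGraphProj = D.treeQuot (n + 1) ≫ (D.S (n + 1)).orbitGraphProj
  rw [← Category.assoc, D.treeStep_quot n, Category.assoc, CovObj.orbitGraphMap_comp_proj]

/-- **Equivariance of `𝔾̃_{n+1} → 𝔾̃_n` along `step : G_{n+1} → G_n`** (the `trans_act` square at the
level of the Galois groups). [cite: MochizukiSemiAnbd2006, Thm 3.7(iii) p.41] -/
theorem treeStep_galAct (n : ℕ) (σ : D.Gal h𝒢 (n + 1)) :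
    (D.galTreeAct h𝒢 (n + 1) σ).hom ≫ D.treeStep n =
      D.treeStep n ≫ (D.galTreeAct h𝒢 n (D.step h𝒢 n σ)).hom := by
  -- the descended automorphism before the base change
  have h1 : (D.galTreeAct h𝒢 n (D.step h𝒢 n σ)).hom =
      eqToHom (congrArg (D.S n).orbitGraph.univCover (congrArg Sum.inl (D.hW n))).symm ≫
        ((D.S n).autUnivCover _ h𝒢 (CovObj.descend (D.g n) (D.W (n + 1)) h𝒢 (D.htrans n) σ)).hom ≫
          eqToHom (congrArg (D.S n).orbitGraph.univCover (congrArg Sum.inl (D.hW n))) :=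
    (D.S n).autUnivCover_conjAut_eqToIso h𝒢 (congrArg Sum.inl (D.hW n)) _
  -- equivariance of `treeMapV` for the pair (σ, descend σ)
  have h2 := CovObj.autUnivCover_hom_comp_treeMapV (D.g n) (D.W (n + 1)) h𝒢 σ
    (CovObj.descend (D.g n) (D.W (n + 1)) h𝒢 (D.htrans n) σ)
    (CovObj.hom_comp_projOver (D.g n) (D.W (n + 1)) h𝒢 (D.htrans n) σ)
  have h2' := congrArg
    (· ≫ eqToHom (congrArg (fun V => (D.S n).orbitGraph.univCover (Sum.inl V)) (D.hW n))) h2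
  simp only [Category.assoc] at h2'
  rw [h1]
  change ((D.S (n + 1)).autUnivCover (Sum.inl (D.W (n + 1))) h𝒢 σ).hom ≫
      CovObj.treeMapV (D.g n) (D.W (n + 1)) ≫ eqToHom _ =
    (CovObj.treeMapV (D.g n) (D.W (n + 1)) ≫ eqToHom _) ≫ eqToHom _ ≫ _ ≫ eqToHom _
  simp only [Category.assoc, eqToHom_trans_assoc, eqToHom_refl, Category.id_comp]
  exact h2'

/-- `ρ_n = step ∘ ρ_{n+1}`. [cite: MochizukiSemiAnbd2006, Prop 3.6 p.38] -/
theorem step_proj (n : ℕ) (g : D.temperedPi h𝒢) :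
    D.step h𝒢 n (D.proj h𝒢 (n + 1) g) = D.proj h𝒢 n g := by
  have h := D.mapLE_proj h𝒢 (Nat.le_succ n) g
  rw [D.mapLE_succ h𝒢 (le_refl n) (Nat.le_succ n), D.mapLE_self] at h
  exact h

/-- **Equivariance of `𝔾̃_{n+1} → 𝔾̃_n` for the action of `π₁^temp`** (the `trans_act` square).
[cite: MochizukiSemiAnbd2006, Thm 3.7(iii) p.41] -/
theorem treeStep_act (n : ℕ) (g : D.temperedPi h𝒢) :
    (D.treeAct h𝒢 (n + 1) g).hom ≫ D.treeStep n = D.treeStep n ≫ (D.treeAct h𝒢 n g).hom := by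
  rw [treeAct_apply, treeAct_apply, ← D.step_proj h𝒢 n g]
  exact D.treeStep_galAct h𝒢 n _

/-! ### The finite levels `𝔾_{S n}` -/

/-- A finite level of a finite `𝔾` has finitely many vertices (the `finiteVertex` field).
[cite: MochizukiSemiAnbd2006, Thm 3.7(iii) p.41] -/
theorem finite_levelVertex [Finite 𝒢.graph.Vertex] (n : ℕ) (hS : (D.S n).IsFinite) :
    Finite (D.S n).orbitGraph.Vertex :=
  (D.S n).finite_oVertex hS

/-- A finite level of a finite `𝔾` has finitely many branches (the `finiteBranch` field).
[cite: MochizukiSemiAnbd2006, Thm 3.7(iii) p.41] -/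
theorem finite_levelBranch [Finite 𝒢.graph.Edge] (n : ℕ) (hS : (D.S n).IsFinite) :
    Finite (D.S n).orbitGraph.Branch :=
  (D.S n).finite_orbitGraph_branch hS

variable (hconn : ∀ (n : ℕ) (p q : (D.S n).Point), (D.S n).SameComponent p q)

/-- The action of `G_n = Aut(𝒢_{∞,n})` on the finite level `𝔾_{S n}` (descent to `S n`, then the
underlying semi-graph), for connected levels. [cite: MochizukiSemiAnbd2006, Thm 3.7(iii) p.41] -/
noncomputable def galLevelAct (n : ℕ) : D.Gal h𝒢 n →* Aut (D.S n).orbitGraph :=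
  (D.S n).levelAut h𝒢 (D.W n) (D.htrans n) (hconn n)

/-- **The action of `π₁^temp` on the finite level `𝔾_{S n}`** (the `levelAct` field).
[cite: MochizukiSemiAnbd2006, Thm 3.7(iii) p.41] -/
noncomputable def levelAct (n : ℕ) : D.temperedPi h𝒢 →* Aut (D.S n).orbitGraph :=
  (D.galLevelAct h𝒢 hconn n).comp (D.proj h𝒢 n)

/-- `levelAct` unfolded. [cite: MochizukiSemiAnbd2006, Thm 3.7(iii) p.41] -/
theorem levelAct_apply (n : ℕ) (g : D.temperedPi h𝒢) :
    D.levelAct h𝒢 hconn n g = D.galLevelAct h𝒢 hconn n (D.proj h𝒢 n g) := rfl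

/-- The `act_quot` square for `G_n`: the action on `𝔾̃_n` covers the action on `𝔾_{S n}`.
[cite: MochizukiSemiAnbd2006, Thm 3.7(iii) p.41] -/
theorem treeQuot_galAct (n : ℕ) (σ : D.Gal h𝒢 n) :
    (D.galTreeAct h𝒢 n σ).hom ≫ D.treeQuot n = D.treeQuot n ≫ (D.galLevelAct h𝒢 hconn n σ).hom :=
  (D.S n).autUnivCover_hom_comp_univCoverProj h𝒢 (D.W n) (D.htrans n) (hconn n) σ

/-- **The `act_quot` square for `π₁^temp`.** [cite: MochizukiSemiAnbd2006, Thm 3.7(iii) p.41] -/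
theorem treeQuot_act (n : ℕ) (g : D.temperedPi h𝒢) :
    (D.treeAct h𝒢 n g).hom ≫ D.treeQuot n = D.treeQuot n ≫ (D.levelAct h𝒢 hconn n g).hom :=
  D.treeQuot_galAct h𝒢 hconn n _

/-- The `levelTrans_act` square for `step : G_{n+1} → G_n`: `𝔾_{S (n+1)} → 𝔾_{S n}` is equivariant.
[cite: MochizukiSemiAnbd2006, Thm 3.7(iii) p.41] -/
theorem levelStep_galAct (n : ℕ) (σ : D.Gal h𝒢 (n + 1)) :
    (D.galLevelAct h𝒢 hconn (n + 1) σ).hom ≫ CovObj.orbitGraphMap (D.g n) =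
      CovObj.orbitGraphMap (D.g n) ≫ (D.galLevelAct h𝒢 hconn n (D.step h𝒢 n σ)).hom := by
  have hd : (D.S n).descendBase h𝒢 (D.W n) (D.htrans n) (D.step h𝒢 n σ).hom =
      (D.S n).descendBase h𝒢 (CovObj.OVertex.map (D.g n) (D.W (n + 1))) (D.htrans n)
        (CovObj.descend (D.g n) (D.W (n + 1)) h𝒢 (D.htrans n) σ).hom :=
    (D.S n).descendBase_conjAut_eqToIso h𝒢 (D.hW n) (D.htrans n) _
  change CovObj.orbitGraphMap ((D.S (n + 1)).descendBase h𝒢 (D.W (n + 1)) (D.htrans (n + 1)) σ.hom) ≫ _ =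
    _ ≫ CovObj.orbitGraphMap ((D.S n).descendBase h𝒢 (D.W n) (D.htrans n) (D.step h𝒢 n σ).hom)
  rw [hd, ← CovObj.orbitGraphMap_comp, ← CovObj.orbitGraphMap_comp,
    (D.S n).descendBase_comp_eq_comp_descendBase h𝒢 (D.g n) (D.W (n + 1)) (D.htrans (n + 1))
      (hconn (n + 1)) (D.htrans n) σ.hom _ (CovObj.hom_comp_projOver (D.g n) (D.W (n + 1)) h𝒢 (D.htrans n) σ)]

/-- **The `levelTrans_act` square for `π₁^temp`.** [cite: MochizukiSemiAnbd2006, Thm 3.7(iii) p.41] -/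
theorem levelStep_act (n : ℕ) (g : D.temperedPi h𝒢) :
    (D.levelAct h𝒢 hconn (n + 1) g).hom ≫ CovObj.orbitGraphMap (D.g n) =
      CovObj.orbitGraphMap (D.g n) ≫ (D.levelAct h𝒢 hconn n g).hom := by
  rw [levelAct_apply, levelAct_apply, ← D.step_proj h𝒢 n g]
  exact D.levelStep_galAct h𝒢 hconn n _

/-- The kernels of the level actions are open. [cite: MochizukiSemiAnbd2006, Thm 3.7(iii) p.41] -/
theorem isOpen_ker_levelAct (n : ℕ) : IsOpen ((D.levelAct h𝒢 hconn n).ker : Set (D.temperedPi h𝒢)) := by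
  refine Subgroup.isOpen_mono (fun g hg => ?_) (D.isOpen_ker_proj h𝒢 n)
  rw [MonoidHom.mem_ker] at hg ⊢
  rw [levelAct_apply, hg, map_one]

/-- Deck transformations of `𝒢_{∞,n} → 𝒢_{S n}` act trivially on the finite level.
[cite: MochizukiSemiAnbd2006, Prop 3.6 p.38] -/
theorem galLevelAct_deckOverAut (n : ℕ) (γ : (D.S n).orbitGraph.FundamentalGroup (Sum.inl (D.W n))) :
    D.galLevelAct h𝒢 hconn n ((D.S n).deckOverAut (Sum.inl (D.W n)) h𝒢 γ) = 1 :=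
  (D.S n).levelAut_deckOverAut h𝒢 (D.W n) (D.htrans n) (hconn n) γ

end GaloisLevelData

end ProfiniteSemiGraph

end Literature.AnabelianGeometry.SemiGraphs
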